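import Mathlib
import HarnessLib
import Summits.ValiantsHypothesis.ValiantsHypothesis.Theses.MonotoneRestoration
import Literature.Computability.AlgebraicComplexity.ArithCircuit
import Literature.Computability.AlgebraicComplexity.ArithCircuitProofs
import Literature.Computability.AlgebraicComplexity.MonotoneStructure
import Literature.Computability.AlgebraicComplexity.PermanentIrreducible
import Literature.ModelTheory.FiniteModelTheory.CkEquiv
import Summits.ValiantsHypothesis.ValiantsHypothesis.Theorems.MonotoneRestorationMonotoneRestorationQPCosetCount
import Summits.ValiantsHypothesis.ValiantsHypothesis.Theorems.MonotoneRestorationMonotoneRestorationQPSymmetricLB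
import Summits.ValiantsHypothesis.ValiantsHypothesis.Theorems.MonotoneRestorationMonotoneRestorationQPSupportSymmetrisation
import Summits.ValiantsHypothesis.ValiantsHypothesis.Theorems.MonotoneRestorationMonotoneRestorationQPSparseRegime
import Summits.ValiantsHypothesis.ValiantsHypothesis.Theorems.MonotoneRestorationMonotoneRestorationQPBeta
import Literature.Computability.AlgebraicComplexity.SymmetricArithCircuit
import Literature.Computability.AlgebraicComplexity.DawarWilsenach2025Proofs
import Literature.GroupTheory.PermutationGroups.SmallIndexSubgroups
import Summits.ValiantsHypothesis.ValiantsHypothesis.Theorems.MonotoneRestorationQP.Negative.LoadBearing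
import Summits.ValiantsHypothesis.ValiantsHypothesis.Theorems.MonotoneRestorationMonotoneRestorationQPPermSupportCount
import Literature.Computability.AlgebraicComplexity.RealTauConjectureDepthFour

/-! TTRL-lite variant V19964 of stmt-ValiantsHypothesis-15886 -/

namespace Summit.ValiantsHypothesis.ValiantsHypothesis.Theorems

open Summit.ValiantsHypothesis.ValiantsHypothesis.Theses.MonotoneRestoration
open Literature.Computability.AlgebraicComplexity

/-- TTRL-lite variant V19964 of `stmt-ValiantsHypothesis-15886` (complexification of a monotone
computation): mapping the constants of a Jerrum–Snir monotone computation `P` of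
`f : MvPolynomial σ ℝ≥0` along `ℝ≥0 → ℝ → ℂ` keeps fan-in two, plainness (a ring homomorphism
sends the sum coefficients `1` to `1`) and size, and the mapped circuit computes
`MvPolynomial.map (ofRealHom ∘ toRealHom) f` (`ArithCircuit.Computes.map`, Bürgisser 2000 §4.1).
[cite: JerrumSnir1982, §2.2] [cite: Burgisser2000, §4.1] -/
theorem stub_monotoneComputation_of_complexity_var19964 :
    ∀ (σ : Type) (P : ArithCircuit NNReal σ) (f : MvPolynomial σ NNReal),
      Literature.Barriers.ValiantsHypothesis.IsMonotoneComputation P f →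
      (P.map (Complex.ofRealHom.comp NNReal.toRealHom)).IsFanInTwo ∧
      Literature.Barriers.ValiantsHypothesis.IsPlain
        (P.map (Complex.ofRealHom.comp NNReal.toRealHom)) ∧
      (P.map (Complex.ofRealHom.comp NNReal.toRealHom)).Computes
        (MvPolynomial.map (Complex.ofRealHom.comp NNReal.toRealHom) f) ∧
      (P.map (Complex.ofRealHom.comp NNReal.toRealHom)).size = P.size := by
  intro σ P f hP
  obtain ⟨hfan, hplain, hcomp⟩ := hP
  refine ⟨hfan.map _, ?_, hcomp.map _, ArithCircuit.size_map _ P⟩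
  intro g hg
  simp only [ArithCircuit.map, List.mem_map] at hg
  obtain ⟨g', hg', rfl⟩ := hg
  cases g' with
  | sum args =>
    have h := (Literature.Barriers.ValiantsHypothesis.isPlainGate_sum_iff args).1 (hplain _ hg')
    simp only [ArithCircuit.Gate.map, Literature.Barriers.ValiantsHypothesis.isPlainGate_sum_iff,
      List.mem_map]
    rintro _ ⟨a, ha, rfl⟩
    simp [h a ha]
  | prod args =>
    simp only [ArithCircuit.Gate.map, Literature.Barriers.ValiantsHypothesis.isPlainGate_prod]

end Summit.ValiantsHypothesis.ValiantsHypothesis.Theorems
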